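import Summits.NavierStokesRegularity.NavierStokesRegularity.Theorems.EulerZoomLiouvillePowerGaugeEulerLiouvilleEnergySaturationCutoff
import Summits.NavierStokesRegularity.NavierStokesRegularity.Theorems.EulerZoomLiouvillePowerGaugeEulerLiouvilleSelfSimilarEndpointProfilePoisson
import Literature.Analysis.FluidPDE.SuitableWeak
import Literature.Analysis.FluidPDE.FlatSwirlGauge
import Literature.Analysis.FluidPDE.BiotSavartCurlPair

/-!
# Crux `EulerZoomLiouville.PowerGaugeEulerLiouville` (stmt-NavierStokesRegularity-19832), line `logtime-breathers` (T3, weak residue):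
# tools for the one-sided profile energy inequality of a WEAK log-time breather

Width seat `ns-ezl-w4` (g3; weak breather rigidity, file C1 — tools for `…BreatherWeakLEI`).  For a profile `V` with `|V|², |V|³ ∈ L¹_loc`,
a pressure profile `Q` with `|Q||V| ∈ L¹_loc` and a test function `σ` (rescaled `σ_L = σ(L⁻¹·)`):

* `BreatherWeak.integrable_cutoff_sq` — `σ_L |V|² ∈ L¹`;
* `BreatherWeak.integrable_sq_inner_gradient` — `|V|²⟪y, ∇σ_L⟫ ∈ L¹`;
* `BreatherWeak.integrable_flux` — the Bernoulli flux integrand `(|V|² + 2Q)⟪V, ∇σ_L⟫ ∈ L¹`;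
* `BreatherWeak.exists_timeBump` — a smooth nonnegative time bump `χ` supported in `[−7/4, −5/4] ⊂ (−2, −1)` with `∫χ > 0`, `∫χ' = 0`
  (a `ContDiffBump`; `∫χ' = 0` by `integral_of_hasDerivAt_of_tendsto`).

WHAT THIS IS NOT: not NS regularity, not the crux — bookkeeping for the WEAK breather-rigidity member; `--supports` stmt-19832. [folklore]
-/

noncomputable section

set_option linter.dupNamespace false

open MeasureTheory Set Filter Topology Metric Function TopologicalSpace
open scoped ENNReal NNReal RealInnerProductSpace ContDiff Laplacian

namespace Summit.NavierStokesRegularity.NavierStokesRegularity.Theorems.PowerGaugeEulerLiouville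

open Literature.Analysis Literature.Analysis.FunctionSpaces Literature.Analysis.FluidPDE

namespace BreatherWeak

variable {u : ℝ → EuclideanSpace ℝ (Fin 3) → EuclideanSpace ℝ (Fin 3)} {p : ℝ → EuclideanSpace ℝ (Fin 3) → ℝ}
  {c : ℝ} {V : EuclideanSpace ℝ (Fin 3) → EuclideanSpace ℝ (Fin 3)} {Q : EuclideanSpace ℝ (Fin 3) → ℝ}
  {σ : EuclideanSpace ℝ (Fin 3) → ℝ}

/-! ### Integrability of the three profile integrands -/

/-- `σ(L⁻¹·)|V|²` is integrable for `|V|² ∈ L¹_loc` and a test function `σ`. [folklore] -/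
theorem integrable_cutoff_sq (hσ : IsTestFunctionOn (⊤ : Opens (EuclideanSpace ℝ (Fin 3))) σ)
    (hV2 : LocallyIntegrable (fun y => ‖V y‖ ^ 2) volume) {L : ℝ} (hL : 0 < L) :
    Integrable (fun x => σ (L⁻¹ • x) * ‖V x‖ ^ 2) volume := by
  have hσL := EnergySaturation.isTestFunctionOn_comp_inv_smul hσ hL.ne'
  have h := hV2.integrable_smul_left_of_hasCompactSupport hσL.contDiff.continuous hσL.hasCompactSupport
  simpa [smul_eq_mul] using h

/-- `|V|²⟪y, ∇σ_L(y)⟫` is integrable for `|V|² ∈ L¹_loc` and a test function `σ`. [folklore] -/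
theorem integrable_sq_inner_gradient (hσ : IsTestFunctionOn (⊤ : Opens (EuclideanSpace ℝ (Fin 3))) σ)
    (hV2 : LocallyIntegrable (fun y => ‖V y‖ ^ 2) volume) {L : ℝ} (hL : 0 < L) :
    Integrable (fun x => ‖V x‖ ^ 2 * ⟪x, gradient (fun z => σ (L⁻¹ • z)) x⟫) volume := by
  have hσL := EnergySaturation.isTestFunctionOn_comp_inv_smul hσ hL.ne'
  have hgc : Continuous fun x : EuclideanSpace ℝ (Fin 3) => ⟪x, gradient (fun z => σ (L⁻¹ • z)) x⟫ :=
    continuous_id.inner (continuous_gradient_of_contDiff (hσL.contDiff.of_le (by exact_mod_cast le_top)))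
  have hgs : HasCompactSupport fun x : EuclideanSpace ℝ (Fin 3) => ⟪x, gradient (fun z => σ (L⁻¹ • z)) x⟫ := by
    refine (hσL.hasCompactSupport.fderiv (𝕜 := ℝ)).mono ?_
    intro x hx
    rw [mem_support] at hx ⊢
    intro h0
    apply hx
    rw [gradient, h0]
    simp
  have h := hV2.integrable_smul_left_of_hasCompactSupport hgc hgs
  refine h.congr (Eventually.of_forall fun x => ?_)
  simp only [smul_eq_mul]
  ring

/-- The Bernoulli flux integrand `(|V|² + 2Q)⟪V, ∇σ_L⟫` is integrable for `|V|³, |Q||V| ∈ L¹_loc`, `V, Q` measurable and a test function `σ`.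
[folklore] -/
theorem integrable_flux (hσ : IsTestFunctionOn (⊤ : Opens (EuclideanSpace ℝ (Fin 3))) σ)
    (hVm : AEStronglyMeasurable V volume) (hQm : AEStronglyMeasurable Q volume)
    (hV3 : LocallyIntegrable (fun y => ‖V y‖ ^ 3) volume)
    (hQV : LocallyIntegrable (fun y => |Q y| * ‖V y‖) volume) {L : ℝ} (hL : 0 < L) :
    Integrable (fun x => (‖V x‖ ^ 2 + 2 * Q x) * ⟪V x, gradient (fun z => σ (L⁻¹ • z)) x⟫) volume := by
  have hσL := EnergySaturation.isTestFunctionOn_comp_inv_smul hσ hL.ne'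
  set g : EuclideanSpace ℝ (Fin 3) → EuclideanSpace ℝ (Fin 3) := gradient (fun z => σ (L⁻¹ • z)) with hg
  have hgc : Continuous g := continuous_gradient_of_contDiff (hσL.contDiff.of_le (by exact_mod_cast le_top))
  have hgs : HasCompactSupport g := by
    refine (hσL.hasCompactSupport.fderiv (𝕜 := ℝ)).mono ?_
    intro x hx
    rw [mem_support] at hx ⊢
    intro h0
    apply hx
    rw [hg, gradient, h0]
    simp
  have hdom : Integrable (fun x => ‖g x‖ • (‖V x‖ ^ 3 + 2 * (|Q x| * ‖V x‖))) volume :=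
    (hV3.add (hQV.smul (2 : ℝ))).integrable_smul_left_of_hasCompactSupport hgc.norm hgs.norm
  refine hdom.mono' ?_ (Eventually.of_forall fun x => ?_)
  · exact ((hVm.norm.pow 2).add (hQm.const_mul 2)).mul (hVm.inner hgc.aestronglyMeasurable)
  · rw [Real.norm_eq_abs, abs_mul, smul_eq_mul]
    have h1 : |⟪V x, g x⟫| ≤ ‖V x‖ * ‖g x‖ := abs_real_inner_le_norm _ _
    have h2 : |‖V x‖ ^ 2 + 2 * Q x| ≤ ‖V x‖ ^ 2 + 2 * |Q x| := by
      calc |‖V x‖ ^ 2 + 2 * Q x| ≤ |‖V x‖ ^ 2| + |2 * Q x| := abs_add_le _ _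
        _ = ‖V x‖ ^ 2 + 2 * |Q x| := by rw [abs_of_nonneg (sq_nonneg _), abs_mul, abs_two]
    calc |‖V x‖ ^ 2 + 2 * Q x| * |⟪V x, g x⟫| ≤ (‖V x‖ ^ 2 + 2 * |Q x|) * (‖V x‖ * ‖g x‖) :=
          mul_le_mul h2 h1 (abs_nonneg _) (by positivity)
      _ = ‖g x‖ * (‖V x‖ ^ 3 + 2 * (|Q x| * ‖V x‖)) := by ring

/-! ### A smooth time bump in `(−2, −1)` -/

/-- A smooth nonnegative time bump `χ` supported in `[−7/4, −5/4] ⊂ (−2,−1)` with positive mass and `∫ χ' = 0`. [folklore] -/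
theorem exists_timeBump : ∃ χ : ℝ → ℝ, ContDiff ℝ (⊤ : ℕ∞) χ ∧ (∀ t, 0 ≤ χ t) ∧ (∀ t, t ∉ Icc (-7/4 : ℝ) (-5/4) → χ t = 0) ∧
    0 < ∫ t, χ t ∧ Integrable χ volume ∧ Integrable (deriv χ) volume ∧ ∫ t, deriv χ t = 0 := by
  let B : ContDiffBump (-3/2 : ℝ) := ⟨1/8, 1/4, by norm_num, by norm_num⟩
  have hcd : ContDiff ℝ (⊤ : ℕ∞) B := B.contDiff
  have hcs : HasCompactSupport (B : ℝ → ℝ) := B.hasCompactSupport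
  have hzero : ∀ t, t ∉ Icc (-7/4 : ℝ) (-5/4) → B t = 0 := by
    intro t ht
    apply B.zero_of_le_dist
    rw [Real.dist_eq]
    by_contra h
    push Not at h
    apply ht
    rw [abs_lt] at h
    constructor <;> [skip; skip] <;> norm_num at h ⊢ <;> linarith [h.1, h.2]
  have hint : Integrable (B : ℝ → ℝ) volume := hcd.continuous.integrable_of_hasCompactSupport hcs
  have hd1 : ContDiff ℝ 1 (B : ℝ → ℝ) := hcd.of_le (by exact_mod_cast le_top)
  have hderiv : ∀ t, HasDerivAt (B : ℝ → ℝ) (deriv B t) t := fun t =>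
    (hd1.differentiable one_ne_zero t).hasDerivAt
  have hdint : Integrable (deriv (B : ℝ → ℝ)) volume :=
    (hd1.continuous_deriv le_rfl).integrable_of_hasCompactSupport hcs.deriv
  have hev : ∀ t, 2 ≤ |t| → (B : ℝ → ℝ) t = 0 := by
    intro t ht
    apply hzero
    intro h
    rw [mem_Icc] at h
    have : |t| < 2 := by rw [abs_lt]; constructor <;> linarith [h.1, h.2]
    linarith
  have hbot : Tendsto (B : ℝ → ℝ) atBot (𝓝 0) := by
    refine tendsto_const_nhds.congr' ?_
    filter_upwards [eventually_le_atBot (-2 : ℝ)] with t ht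
    exact (hev t (by rw [abs_of_nonpos (by linarith)]; linarith)).symm
  have htop : Tendsto (B : ℝ → ℝ) atTop (𝓝 0) := by
    refine tendsto_const_nhds.congr' ?_
    filter_upwards [eventually_ge_atTop (2 : ℝ)] with t ht
    exact (hev t (by rw [abs_of_nonneg (by linarith)]; linarith)).symm
  have hI0 := integral_of_hasDerivAt_of_tendsto hderiv hdint hbot htop
  refine ⟨B, hcd, fun t => B.nonneg, hzero, B.integral_pos, hint, hdint, by rw [hI0, sub_zero]⟩

end BreatherWeak

end Summit.NavierStokesRegularity.NavierStokesRegularity.Theorems.PowerGaugeEulerLiouville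

end
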